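/-
Origin: expansion seat `planner-pub-hodgecm-pv10-g4-0`, handover #9 2026-08-18T12:26:27Z (`HOME/pub-hodgecm-pv10-g4/lean/Pv10g4/CongruenceLatticeTower.lean`, md5 adccb797, 288 lines);
landed by the gen-8 packager in gate run 29 as `HodgeCM/PerL34/CongruenceLatticeTower.lean` (import ^import Pv10g4\.SmallLevelTorsionFree[ \t]*$→import HodgeCM.PerL34.SmallLevelTorsionFree ×1; stripped 9 #print/#check/#eval lines).
-/
/-
Origin: HOME/pub-hodgecm-pv10-g4/lean/Pv10g4/CongruenceLatticeTower.lean (WIP module `Pv10g4.CongruenceLatticeTower`;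
intended final place `HodgeCM/PerL34/CongruenceLatticeTower.lean` = module `HodgeCM.PerL34.CongruenceLatticeTower`)
(import rewrite on landing: `import Pv10g4.SmallLevelTorsionFree` ↦ `import HodgeCM.PerL34.SmallLevelTorsionFree`).
-/
import Summits.HodgeConjecture.HodgeCM.PerL34.SmallLevelTorsionFree_2

/-!
# The tower `Γ_H(K₁) ⊴ Γ_H(K_f)` of congruence lattices (PerL v5 ll. 74–75, KERNEL, group level)

PerL v5 §1.2, ll. 74–75: "… there is a neat normal `K_1 ⊂ K_f` of finite index with `P^L_{Γ_1} → P^L_Γ` finite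
étale, `Γ_1 = G_U(L_0) ∩ K_1`" and "`P_{K_f}` is the quotient of `P_{K_1}` by the finite group `K_f/K_1`".
Rows #4/#6/#8 of this seat give the lattices `Γ_H(K_f) = congruenceLattice L H Kf ≤ U(H)_∞`, their cofinal
normal finite-index small levels `K₁ ≤ K_f ∩ K_H(n)` and the torsion-freeness of every `Γ_H(g K₁ g⁻¹)`.  This file
supplies the remaining GROUP-LEVEL content of the two quoted sentences — how the lattice changes with the level:

* §1 `congruenceLattice_mono` — `K₁ ≤ K_f ⇒ Γ_H(K₁) ≤ Γ_H(K_f)`;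
* §2 `ratLift`, `finPart` — the rational lift `a ↦ γ(a) ∈ U(H)(L⁺)` (`γ(a)_∞ = a`, unique by row #4's
  `injOn_splitEquiv_fst_adelicUnitaryRat`) and the FINITE-PART HOMOMORPHISM `Γ_H(K_f) →* K_f`, `a ↦ γ(a)_f`;
* §3 `subgroupOf_congruenceLattice` — `Γ_H(K₁) ∩ Γ_H(K_f)`, as a subgroup of `Γ_H(K_f)`, is the PREIMAGE of
  `K₁ ∩ K_f ≤ K_f` under the finite-part homomorphism; hence (§4) `K₁ ⊴ K_f ⇒ Γ_H(K₁) ⊴ Γ_H(K_f)`,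
  `[K_f : K₁] < ∞ ⇒ [Γ_H(K_f) : Γ_H(K₁)] < ∞`, and for normal `K₁` the INJECTIVE homomorphism
  `quotientToLevelQuotient : Γ_H(K_f)/Γ_H(K₁) ↪ K_f/K₁` (`injective_quotientToLevelQuotient`; `K_f/K₁` is the finite
  group acting on `P_{K_1}` with quotient `P_{K_f}` in PerL l. 75), so `[Γ_H(K_f) : Γ_H(K₁)]` DIVIDES `[K_f : K₁]`;
* §5 the same after conjugating the pair `(K₁, K_f)` by any `g ∈ U(H)(𝔸_{L₀,f})` (the pieces `Γ_j` of row #7's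
  decomposition `S(K_f) = ⨆_j Γ_j\X` are `Γ_H(g_j K_f g_j⁻¹)`);
* §6 HEADLINE `exists_torsionFree_normal_tower` (any hermitian `H`, and `HodgeCM.HermSpace3.…` for `G_U`): for every
  compact open `K_f` there is ONE compact open `K₁ ≤ K_f ∩ K_H(3)`, normal of finite index in `K_f`, such that for
  EVERY `g` the lattice `Γ_H(g K₁ g⁻¹)` is a TORSION-FREE NORMAL subgroup of FINITE INDEX dividing `[K_f : K₁]` in
  `Γ_H(g K_f g⁻¹)` — i.e. every piece `Γ_j(K_f)\X` of `S(K_f)` is the quotient of the free quotient `Γ_j(K₁)\X` by the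
  finite group `Γ_j(K_f)/Γ_j(K₁) ↪ K_f/K₁`.  (The GEOMETRIC half of ll. 74–75 — "finite étale", "smooth projective" —
  needs the complex structure on `Γ\𝔹²` and Baily–Borel/Kodaira and is NOT claimed here.)

All statements are kernel theorems over rows #4/#6/#8 and Mathlib (no cited facts); every `#print axioms` below is
the standard trio.
-/

noncomputable section

open scoped Pointwise
open NumberField
open HodgeCM.Adelic HodgeCM.PerL34.AdelicUnitaryFactorisation

namespace HodgeCM.PerL34.Godement

/-! ## §1–§4  Monotonicity, the finite-part homomorphism, normality and index -/

section Tower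

variable (L : CMField) {m : ℕ} (H : Matrix (Fin m) (Fin m) L)

/-- `K₁ ≤ K_f ⇒ Γ_H(K₁) ≤ Γ_H(K_f)`. -/
theorem congruenceLattice_mono {K₁ Kf : Subgroup (Ufin L H)} (h : K₁ ≤ Kf) :
    congruenceLattice L H K₁ ≤ congruenceLattice L H Kf := by
  intro a ha
  obtain ⟨γ, hγ, hγK, hγa⟩ := (mem_congruenceLattice_iff L H K₁ a).1 ha
  exact (mem_congruenceLattice_iff L H Kf a).2 ⟨γ, hγ, h hγK, hγa⟩

/-- The RATIONAL LIFT `Γ_H(K_f) →* U(H)(𝔸_{L₀})`: `a ↦` the unique `γ ∈ U(H)(L⁺)` with `γ_f ∈ K_f` and `γ_∞ = a`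
(inverse of row #4's `congruenceLatticeEquiv`, followed by the inclusion). -/
def ratLift (Kf : Subgroup (Ufin L H)) : congruenceLattice L H Kf →* adelicUnitaryGroup L H :=
  (Subgroup.subtype _).comp (congruenceLatticeEquiv L H Kf).symm.toMonoidHom

/-- (Ported verbatim from the HodgeCMPerL package; no docstring in the source.) -/
theorem ratLift_mem (Kf : Subgroup (Ufin L H)) (a : congruenceLattice L H Kf) :
    ratLift L H Kf a ∈ adelicUnitaryRat L H ⊓ levelSubgroup (splitEquiv L H) Kf :=
  ((congruenceLatticeEquiv L H Kf).symm a).2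

/-- (Ported verbatim from the HodgeCMPerL package; no docstring in the source.) -/
theorem ratLift_mem_adelicUnitaryRat (Kf : Subgroup (Ufin L H)) (a : congruenceLattice L H Kf) :
    ratLift L H Kf a ∈ adelicUnitaryRat L H :=
  (Subgroup.mem_inf.mp (ratLift_mem L H Kf a)).1

/-- (Ported verbatim from the HodgeCMPerL package; no docstring in the source.) -/
theorem snd_splitEquiv_ratLift_mem (Kf : Subgroup (Ufin L H)) (a : congruenceLattice L H Kf) :
    (splitEquiv L H (ratLift L H Kf a)).2 ∈ Kf :=
  (Subgroup.mem_inf.mp (ratLift_mem L H Kf a)).2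

/-- (Ported verbatim from the HodgeCMPerL package; no docstring in the source.) -/
theorem fst_splitEquiv_ratLift (Kf : Subgroup (Ufin L H)) (a : congruenceLattice L H Kf) :
    (splitEquiv L H (ratLift L H Kf a)).1 = a := by
  have h := coe_congruenceLatticeEquiv_apply L H Kf ((congruenceLatticeEquiv L H Kf).symm a)
  rw [MulEquiv.apply_symm_apply] at h
  exact h.symm

/-- Uniqueness of the rational lift: a rational `γ` with `γ_∞ = a` IS `ratLift a` (row #4: `pr_∞` is injective on
`U(H)(L⁺)`). -/
theorem eq_ratLift {Kf : Subgroup (Ufin L H)} {a : congruenceLattice L H Kf} {γ : adelicUnitaryGroup L H}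
    (hγ : γ ∈ adelicUnitaryRat L H) (hγa : (splitEquiv L H γ).1 = a) : γ = ratLift L H Kf a :=
  injOn_splitEquiv_fst_adelicUnitaryRat L H hγ (ratLift_mem_adelicUnitaryRat L H Kf a)
    (hγa.trans (fst_splitEquiv_ratLift L H Kf a).symm)

/-- The FINITE-PART HOMOMORPHISM `Γ_H(K_f) →* K_f`, `a ↦ γ(a)_f`. -/
def finPart (Kf : Subgroup (Ufin L H)) : congruenceLattice L H Kf →* Kf :=
  ((prB (splitEquiv L H)).comp (ratLift L H Kf)).codRestrict Kf (snd_splitEquiv_ratLift_mem L H Kf)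

/-- (Ported verbatim from the HodgeCMPerL package; no docstring in the source.) -/
theorem coe_finPart_apply (Kf : Subgroup (Ufin L H)) (a : congruenceLattice L H Kf) :
    ((finPart L H Kf a : Kf) : Ufin L H) = (splitEquiv L H (ratLift L H Kf a)).2 := rfl

/-- **`Γ_H(K₁) ∩ Γ_H(K_f) ≤ Γ_H(K_f)` is the preimage of `K₁ ∩ K_f ≤ K_f` under the finite-part homomorphism.** -/
theorem subgroupOf_congruenceLattice (K₁ Kf : Subgroup (Ufin L H)) :
    (congruenceLattice L H K₁).subgroupOf (congruenceLattice L H Kf) =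
      (K₁.subgroupOf Kf).comap (finPart L H Kf) := by
  ext a
  rw [Subgroup.mem_subgroupOf, Subgroup.mem_comap, Subgroup.mem_subgroupOf, coe_finPart_apply,
    mem_congruenceLattice_iff]
  constructor
  · rintro ⟨γ, hγ, hγK, hγa⟩
    rwa [← eq_ratLift L H hγ hγa]
  · intro hK
    exact ⟨ratLift L H Kf a, ratLift_mem_adelicUnitaryRat L H Kf a, hK, fst_splitEquiv_ratLift L H Kf a⟩

/-- `K₁ ⊴ K_f` (as a subgroup of `K_f`) `⇒ Γ_H(K₁) ⊴ Γ_H(K_f)` (an `instance`, so that the quotient GROUP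
`Γ_H(K_f)/Γ_H(K₁)` below makes sense). -/
instance normal_congruenceLattice_subgroupOf (K₁ Kf : Subgroup (Ufin L H)) [(K₁.subgroupOf Kf).Normal] :
    ((congruenceLattice L H K₁).subgroupOf (congruenceLattice L H Kf)).Normal := by
  rw [subgroupOf_congruenceLattice]
  infer_instance

/-- The kernel of `Γ_H(K_f) → K_f → K_f/K₁` is `Γ_H(K₁) ∩ Γ_H(K_f)`. -/
theorem ker_mk'_comp_finPart (K₁ Kf : Subgroup (Ufin L H)) [(K₁.subgroupOf Kf).Normal] :
    ((QuotientGroup.mk' (K₁.subgroupOf Kf)).comp (finPart L H Kf)).ker =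
      (congruenceLattice L H K₁).subgroupOf (congruenceLattice L H Kf) := by
  rw [← MonoidHom.comap_ker, QuotientGroup.ker_mk', subgroupOf_congruenceLattice]

/-- **`Γ_H(K_f)/Γ_H(K₁) →* K_f/K₁`** (the finite group of PerL l. 75): the homomorphism induced by the finite part. -/
def quotientToLevelQuotient (K₁ Kf : Subgroup (Ufin L H)) [(K₁.subgroupOf Kf).Normal] :
    congruenceLattice L H Kf ⧸ (congruenceLattice L H K₁).subgroupOf (congruenceLattice L H Kf) →*
      Kf ⧸ K₁.subgroupOf Kf :=
  QuotientGroup.lift _ ((QuotientGroup.mk' (K₁.subgroupOf Kf)).comp (finPart L H Kf))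
    (ker_mk'_comp_finPart L H K₁ Kf).ge

/-- (Ported verbatim from the HodgeCMPerL package; no docstring in the source.) -/
theorem quotientToLevelQuotient_mk (K₁ Kf : Subgroup (Ufin L H)) [(K₁.subgroupOf Kf).Normal]
    (a : congruenceLattice L H Kf) :
    quotientToLevelQuotient L H K₁ Kf a = ((finPart L H Kf a : Kf) : Kf ⧸ K₁.subgroupOf Kf) := rfl

/-- **`Γ_H(K_f)/Γ_H(K₁) ↪ K_f/K₁` is injective.** -/
theorem injective_quotientToLevelQuotient (K₁ Kf : Subgroup (Ufin L H)) [(K₁.subgroupOf Kf).Normal] :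
    Function.Injective (quotientToLevelQuotient L H K₁ Kf) :=
  (MonoidHom.ker_eq_bot_iff _).mp (by
    show (QuotientGroup.lift _ ((QuotientGroup.mk' (K₁.subgroupOf Kf)).comp (finPart L H Kf)) _).ker = ⊥
    rw [QuotientGroup.ker_lift, ker_mk'_comp_finPart, QuotientGroup.map_mk'_self])

/-- `[K_f : K₁ ∩ K_f] < ∞ ⇒ [Γ_H(K_f) : Γ_H(K₁) ∩ Γ_H(K_f)] < ∞`. -/
theorem finiteIndex_congruenceLattice_subgroupOf (K₁ Kf : Subgroup (Ufin L H))
    [hF : (K₁.subgroupOf Kf).FiniteIndex] :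
    ((congruenceLattice L H K₁).subgroupOf (congruenceLattice L H Kf)).FiniteIndex := by
  rw [subgroupOf_congruenceLattice]
  refine ⟨fun h0 => hF.index_ne_zero ?_⟩
  rw [Subgroup.index_comap] at h0
  exact Subgroup.index_eq_zero_of_relIndex_eq_zero h0

/-- The relative index is finite: `[Γ_H(K_f) : Γ_H(K₁) ∩ Γ_H(K_f)] ≠ 0` whenever `[K_f : K₁ ∩ K_f] ≠ 0`. -/
theorem relIndex_congruenceLattice_ne_zero {K₁ Kf : Subgroup (Ufin L H)} (h : K₁.relIndex Kf ≠ 0) :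
    (congruenceLattice L H K₁).relIndex (congruenceLattice L H Kf) ≠ 0 := by
  haveI : (K₁.subgroupOf Kf).FiniteIndex := ⟨h⟩
  exact (finiteIndex_congruenceLattice_subgroupOf L H K₁ Kf).index_ne_zero

/-- **For `K₁` normal in `K_f`, `[Γ_H(K_f) : Γ_H(K₁) ∩ Γ_H(K_f)]` divides `[K_f : K₁ ∩ K_f]`**: the finite-part
homomorphism embeds `Γ_H(K_f)/Γ_H(K₁)` into `K_f/K₁`. -/
theorem relIndex_congruenceLattice_dvd (K₁ Kf : Subgroup (Ufin L H)) [(K₁.subgroupOf Kf).Normal] :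
    (congruenceLattice L H K₁).relIndex (congruenceLattice L H Kf) ∣ K₁.relIndex Kf := by
  show ((congruenceLattice L H K₁).subgroupOf (congruenceLattice L H Kf)).index ∣ (K₁.subgroupOf Kf).index
  rw [subgroupOf_congruenceLattice, Subgroup.index_comap]
  exact Subgroup.relIndex_dvd_index_of_normal (K₁.subgroupOf Kf) (finPart L H Kf).range

/-- The finite-part homomorphism is compatible with shrinking the level: on `Γ_H(K₁) ≤ Γ_H(K_f)` (`K₁ ≤ K_f`) the
two rational lifts agree. -/
theorem ratLift_inclusion {K₁ Kf : Subgroup (Ufin L H)} (h : K₁ ≤ Kf) (a : congruenceLattice L H K₁) :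
    ratLift L H Kf (Subgroup.inclusion (congruenceLattice_mono L H h) a) = ratLift L H K₁ a :=
  (eq_ratLift L H (ratLift_mem_adelicUnitaryRat L H K₁ a) (by
    rw [fst_splitEquiv_ratLift, Subgroup.coe_inclusion])).symm

/-- (Ported verbatim from the HodgeCMPerL package; no docstring in the source.) -/
theorem coe_finPart_inclusion {K₁ Kf : Subgroup (Ufin L H)} (h : K₁ ≤ Kf) (a : congruenceLattice L H K₁) :
    ((finPart L H Kf (Subgroup.inclusion (congruenceLattice_mono L H h) a) : Kf) : Ufin L H) =
      ((finPart L H K₁ a : K₁) : Ufin L H) := by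
  rw [coe_finPart_apply, coe_finPart_apply, ratLift_inclusion L H h]

end Tower

/-! ## §5  Conjugate pairs `(g K₁ g⁻¹, g K_f g⁻¹)` -/

section Conj

variable (L : CMField) {m : ℕ} (H : Matrix (Fin m) (Fin m) L)

/-- (Ported verbatim from the HodgeCMPerL package; no docstring in the source.) -/
theorem conj_smul_mono {K₁ Kf : Subgroup (Ufin L H)} (h : K₁ ≤ Kf) (g : Ufin L H) :
    MulAut.conj g • K₁ ≤ MulAut.conj g • Kf :=
  Subgroup.pointwise_smul_le_pointwise_smul_iff.mpr h

/-- Conjugation preserves normality of the pair. -/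
theorem normal_subgroupOf_conj_smul {K₁ Kf : Subgroup (Ufin L H)} (h : K₁ ≤ Kf) [hN : (K₁.subgroupOf Kf).Normal]
    (g : Ufin L H) : ((MulAut.conj g • K₁).subgroupOf (MulAut.conj g • Kf)).Normal := by
  rw [Subgroup.normal_subgroupOf_iff (conj_smul_mono L H h g)]
  intro n k hn hk
  rw [Subgroup.mem_pointwise_smul_iff_inv_smul_mem] at hn hk ⊢
  have key := (Subgroup.normal_subgroupOf_iff h).mp hN _ _ hn hk
  simpa only [smul_mul', smul_inv'] using key

/-- Conjugation preserves the relative index of the pair. -/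
theorem relIndex_conj_smul (K₁ Kf : Subgroup (Ufin L H)) (g : Ufin L H) :
    (MulAut.conj g • K₁).relIndex (MulAut.conj g • Kf) = K₁.relIndex Kf :=
  Subgroup.relIndex_pointwise_smul (h := MulAut.conj g) K₁ Kf

/-- Conjugation preserves finiteness of the relative index of the pair. -/
theorem finiteIndex_subgroupOf_conj_smul (K₁ Kf : Subgroup (Ufin L H)) [hF : (K₁.subgroupOf Kf).FiniteIndex]
    (g : Ufin L H) : ((MulAut.conj g • K₁).subgroupOf (MulAut.conj g • Kf)).FiniteIndex :=
  ⟨show (MulAut.conj g • K₁).relIndex (MulAut.conj g • Kf) ≠ 0 by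
    rw [relIndex_conj_smul]; exact hF.index_ne_zero⟩

end Conj

/-! ## §6  Headline: one small normal level serves every piece -/

section Headline

variable (L : CMField) {m : ℕ} (H : Matrix (Fin m) (Fin m) L)

/-- **PerL v5 ll. 74–75, group level (KERNEL), for any hermitian `H`.**  For every compact open level
`K_f ≤ U(H)(𝔸_{L₀,f})` there is a compact open `K₁ ≤ K_f ∩ K_H(3)`, NORMAL of FINITE INDEX in `K_f`, such that for
EVERY `g ∈ U(H)(𝔸_{L₀,f})` the congruence lattice `Γ_H(g K₁ g⁻¹)` is contained in `Γ_H(g K_f g⁻¹)` as a TORSION-FREE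
NORMAL subgroup of FINITE INDEX dividing `[K_f : K₁]`.  (So each piece `Γ_j(K_f)\X` of `S(K_f)` — row #7 — is the
quotient of `Γ_j(K₁)\X`, a quotient by a FREE action when `X` has compact stabilisers — row #5/#8 — by the finite
group `Γ_j(K_f)/Γ_j(K₁) ↪ K_f/K₁`.) -/
theorem exists_torsionFree_normal_tower (Kf : Subgroup (Ufin L H)) (hKo : IsOpen (Kf : Set (Ufin L H)))
    (hKc : IsCompact (Kf : Set (Ufin L H))) :
    ∃ K₁ : Subgroup (Ufin L H), K₁ ≤ Kf ∧ K₁ ≤ levelUfin L H 3 ∧ IsOpen (K₁ : Set (Ufin L H)) ∧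
      IsCompact (K₁ : Set (Ufin L H)) ∧ (K₁.subgroupOf Kf).Normal ∧ (K₁.subgroupOf Kf).FiniteIndex ∧
      ∀ g : Ufin L H,
        congruenceLattice L H (MulAut.conj g • K₁) ≤ congruenceLattice L H (MulAut.conj g • Kf) ∧
        ((congruenceLattice L H (MulAut.conj g • K₁)).subgroupOf
            (congruenceLattice L H (MulAut.conj g • Kf))).Normal ∧
        ((congruenceLattice L H (MulAut.conj g • K₁)).subgroupOf
            (congruenceLattice L H (MulAut.conj g • Kf))).FiniteIndex ∧
        (congruenceLattice L H (MulAut.conj g • K₁)).relIndex (congruenceLattice L H (MulAut.conj g • Kf)) ∣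
          K₁.relIndex Kf ∧
        ∀ γ ∈ congruenceLattice L H (MulAut.conj g • K₁), IsOfFinOrder γ → γ = 1 := by
  obtain ⟨K₁, hK₁, hK₁lev, hK₁o, hK₁c, hN, hF⟩ := exists_normal_finiteIndex_le_levelUfin L H Kf hKo hKc 3
  refine ⟨K₁, hK₁, hK₁lev, hK₁o, hK₁c, hN, hF, fun g => ?_⟩
  haveI := normal_subgroupOf_conj_smul L H hK₁ g
  haveI := finiteIndex_subgroupOf_conj_smul L H K₁ Kf g
  refine ⟨congruenceLattice_mono L H (conj_smul_mono L H hK₁ g),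
    normal_congruenceLattice_subgroupOf L H _ _, finiteIndex_congruenceLattice_subgroupOf L H _ _, ?_,
    torsionFree_congruenceLattice_conj L le_rfl hK₁lev g⟩
  rw [← relIndex_conj_smul L H K₁ Kf g]
  exact relIndex_congruenceLattice_dvd L H _ _

end Headline

end HodgeCM.PerL34.Godement

/-! ## §7  The `G_U` case (`V : HermSpace3 L ι₁`) -/

namespace HodgeCM.HermSpace3

open HodgeCM.PerL34.Godement

variable (L : CMField) {ι₁ : L →+* ℂ} (V : HermSpace3 L ι₁)

/-- **PerL v5 ll. 74–75 for `G_U = U(V₃, h)`, group level (KERNEL).**  For every compact open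
`K_f ≤ G_U(𝔸_{L₀,f})` there is a compact open `K₁ ≤ K_f ∩ K_H(3)`, normal of finite index in `K_f`, such that every
`Γ_j(K₁) := Γ(g_j K₁ g_j⁻¹)` is a torsion-free normal subgroup of `Γ_j(K_f) = Γ(g_j K_f g_j⁻¹)` of finite index dividing
`[K_f : K₁]` — the group-level content of "there is a neat normal `K_1 ⊂ K_f` of finite index with
`P^L_{Γ_1} → P^L_Γ` finite étale" and "`P_{K_f}` is the quotient of `P_{K_1}` by the finite group `K_f/K_1`". -/
theorem exists_torsionFree_normal_tower (Kf : Subgroup (Ufin L V.Hm)) (hKo : IsOpen (Kf : Set (Ufin L V.Hm)))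
    (hKc : IsCompact (Kf : Set (Ufin L V.Hm))) :
    ∃ K₁ : Subgroup (Ufin L V.Hm), K₁ ≤ Kf ∧ K₁ ≤ levelUfin L V.Hm 3 ∧ IsOpen (K₁ : Set (Ufin L V.Hm)) ∧
      IsCompact (K₁ : Set (Ufin L V.Hm)) ∧ (K₁.subgroupOf Kf).Normal ∧ (K₁.subgroupOf Kf).FiniteIndex ∧
      ∀ g : Ufin L V.Hm,
        congruenceLattice L V.Hm (MulAut.conj g • K₁) ≤ congruenceLattice L V.Hm (MulAut.conj g • Kf) ∧
        ((congruenceLattice L V.Hm (MulAut.conj g • K₁)).subgroupOf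
            (congruenceLattice L V.Hm (MulAut.conj g • Kf))).Normal ∧
        ((congruenceLattice L V.Hm (MulAut.conj g • K₁)).subgroupOf
            (congruenceLattice L V.Hm (MulAut.conj g • Kf))).FiniteIndex ∧
        (congruenceLattice L V.Hm (MulAut.conj g • K₁)).relIndex
            (congruenceLattice L V.Hm (MulAut.conj g • Kf)) ∣ K₁.relIndex Kf ∧
        ∀ γ ∈ congruenceLattice L V.Hm (MulAut.conj g • K₁), IsOfFinOrder γ → γ = 1 :=
  HodgeCM.PerL34.Godement.exists_torsionFree_normal_tower L V.Hm Kf hKo hKc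

end HodgeCM.HermSpace3

end

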